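import Mathlib.LinearAlgebra.Eigenspace.Pi
import Mathlib.LinearAlgebra.Eigenspace.Semisimple
import Mathlib.LinearAlgebra.Eigenspace.Triangularizable
import Mathlib.FieldTheory.Minpoly.IsConjRoot
import Literature.AlgebraicGeometry.Motives.MumfordTateInvariantsSemisimple
import HarnessLib

/-!
# Joint eigenvectors of a commuting semisimple rational family span the complexification (Deligne, LNM 900, §4: `H¹_B ⊗ ℂ = ⊕_σ H¹_{B,σ}`, all eigensystems at once)

Topic `Literature/AlgebraicGeometry/ComplexMultiplication`, the ALGEBRA companion of
`EigenblockOfCommutingEndomorphisms` (one eigensystem `t : R →ₐ[ℚ] ℂ` of a commutative `ℚ`-algebra acting on a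
`ℚ`-vector space `V`) and the supplier of the hypothesis `hspan` of
`HodgeTheory.CMTypeOfCommutingRationalAction.isOfCMType_of_forall_eigensystem_oneType` /
`Motives.AlbaneseCMTypeOfOneTypeEigensystems` («`H¹ ⊗ ℂ` is spanned by joint eigenvectors of the eigensystems»).
PROOF FILE: theorems only — no definition, no named fact, sorry-free (D-0026). Written for the cell `pub-hodgecm2`
(COR-CM), route R-A («the Albanese variety of a Picard modular surface is of CM-type»): there the algebra is an algebra
of Hecke correspondences acting on `H¹`, which acts SEMISIMPLY; nothing automorphic is stated here.

## Source

* P. Deligne, *Hodge cycles on abelian varieties*, LNM 900 (1982), Example 3.7 (`E ⊗_ℚ ℂ ≃ ℂ^{Hom(E,ℂ)}` for a product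
  of fields `E`) and §4 (`H¹_B ⊗ ℂ = ⊕_σ H¹_{B,σ}`): a commutative semisimple `ℚ`-algebra acting on `V` decomposes
  `V ⊗ ℂ` into the joint eigenspaces of its `ℂ`-valued algebra homomorphisms.
* A. Borel, *Linear Algebraic Groups*, 2nd ed., GTM 126 (1991), §4.2 and Prop. 4.6: a commuting family of semisimple
  endomorphisms is simultaneously diagonalisable over an algebraically closed field (Mathlib:
  `Module.End.iSup_iInf_maxGenEigenspace_eq_top_of_iSup_maxGenEigenspace_eq_top_of_commute` + semisimple ⇒
  `maxGenEigenspace = eigenspace`).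

## What is proved (unconditional, sorry-free; `V` finite-dimensional over `ℚ`)

* §1 families `f : κ → End_ℚ V`, pairwise commuting, each `f k` semisimple (or only each `(f k)_ℂ` semisimple —
  the `_baseChange` variants, for semisimplicity proved analytically, e.g. by normality):
  `iSup_iInf_eigenspace_baseChange_eq_top` (`⨆_{χ : κ → ℂ} ⋂ₖ Eig((f k)_ℂ, χ k) = ⊤`) and
  **`mem_span_jointEigenvectors_of_isSemisimple`** (every `x ∈ ℂ ⊗ V` is a `ℂ`-combination of joint eigenvectors).
* §2 algebras `act : R →ₐ[ℚ] End_ℚ V`: `exists_algHom_eq_of_eigenvector_ne_zero` (the eigencharacter `χ : R → ℂ` of a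
  NON-ZERO joint eigenvector is a `ℚ`-algebra homomorphism `t : R →ₐ[ℚ] ℂ` — an EIGENSYSTEM in the sense of
  `EigenblockOfCommutingEndomorphisms`), **`mem_span_eigensystemVectors_of_isSemisimple`** (+ `_baseChange`) (if every
  `act a` — or every `(act a)_ℂ` — is semisimple, `ℂ ⊗ V` is spanned by `{w | ∃ t : R →ₐ[ℚ] ℂ, ∀ a, (act a)_ℂ w = t a • w}` — LITERALLY the hypothesis
  `hspan` of `isOfCMType_of_forall_eigensystem_oneType`).
* §3 where semisimplicity comes from: `isSemisimple_apply_of_isReduced` (`R` a reduced finite `ℚ`-algebra, e.g. a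
  product of number fields), `isSemisimple_apply_of_isNilpotent_imp_eq_zero` (the IMAGE of `act` is reduced: no non-zero
  nilpotent `act a`), with the corresponding span statements `mem_span_eigensystemVectors_of_isReduced` /
  `mem_span_eigensystemVectors_of_isNilpotent_imp_eq_zero`.

Only `ℚ`- and `ℂ`-coefficients occur. The formulation is ours; the nearest printed statements are Deligne's
Example 3.7 / §4 and Borel §4.2.

## References

* [Deligne1982HodgeCycles] P. Deligne, *Hodge cycles on abelian varieties*, LNM 900 (1982), Example 3.7, §4.
* A. Borel, *Linear Algebraic Groups*, 2nd ed., GTM 126 (1991), §4.2.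
-/

noncomputable section

open scoped TensorProduct
open Module

namespace Literature.AlgebraicGeometry.ComplexMultiplication

/-! ## §1 Commuting semisimple families: joint eigenvectors span `ℂ ⊗ V` -/

section Family

variable {κ : Type*} {V : Type*} [AddCommGroup V] [Module ℚ V] [Module.Finite ℚ V]

/-- **Simultaneous diagonalisation over `ℂ` (semisimplicity checked after complexification).** For a pairwise
commuting family `f : κ → End_ℚ V` on a finite-dimensional `ℚ`-vector space whose COMPLEXIFICATIONS `(f k)_ℂ` are
semisimple (e.g. normal for a hermitian inner product on `ℂ ⊗ V`), the joint eigenspaces exhaust `ℂ ⊗_ℚ V`: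
`⨆_{χ : κ → ℂ} ⋂ₖ Eig((f k)_ℂ, χ k) = ⊤` (maximal generalised eigenspaces of a semisimple endomorphism are
eigenspaces, and a commuting family is simultaneously triangularisable over the algebraically closed field `ℂ`).
[cite: Deligne1982HodgeCycles, Example 3.7 and §4 (p. 30, `H¹_B ⊗ ℂ = ⊕_σ H¹_{B,σ}`)] -/
theorem iSup_iInf_eigenspace_eq_top_of_isSemisimple_baseChange (f : κ → Module.End ℚ V)
    (hf : ∀ k l, f k * f l = f l * f k) (hss : ∀ k, Module.End.IsSemisimple ((f k).baseChange ℂ)) :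
    ⨆ χ : κ → ℂ, ⨅ k, Module.End.eigenspace ((f k).baseChange ℂ) (χ k) = ⊤ := by
  set g : κ → Module.End ℂ (ℂ ⊗[ℚ] V) := fun k => (f k).baseChange ℂ with hg
  have hcomm : Pairwise fun k l => Commute (g k) (g l) := fun k l _ => by
    change g k * g l = g l * g k
    simp only [hg, ← LinearMap.baseChange_mul, hf k l]
  have h' : ∀ k, ⨆ μ : ℂ, (g k).maxGenEigenspace μ = ⊤ := fun k =>
    Module.End.iSup_maxGenEigenspace_eq_top (g k)
  have key :=
    Module.End.iSup_iInf_maxGenEigenspace_eq_top_of_iSup_maxGenEigenspace_eq_top_of_commute g hcomm h'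
  have hss' : ∀ k, (g k).IsFinitelySemisimple := fun k => (hss k).isFinitelySemisimple
  have e : ∀ χ : κ → ℂ, (⨅ k, (g k).maxGenEigenspace (χ k)) = ⨅ k, (g k).eigenspace (χ k) :=
    fun χ => iInf_congr fun k => (hss' k).maxGenEigenspace_eq_eigenspace (χ k)
  simpa only [e] using key

/-- **Simultaneous diagonalisation over `ℂ`.** For a pairwise commuting family `f : κ → End_ℚ V` of SEMISIMPLE
endomorphisms of a finite-dimensional `ℚ`-vector space, the joint eigenspaces of the complexified family exhaust
`ℂ ⊗_ℚ V`: `⨆_{χ : κ → ℂ} ⋂ₖ Eig((f k)_ℂ, χ k) = ⊤` (each `(f k)_ℂ` is semisimple — separable minimal polynomial,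
the tree's `Motives.isSemisimple_baseChange`). [cite: Deligne1982HodgeCycles, Example 3.7 and §4 (p. 30, `H¹_B ⊗ ℂ = ⊕_σ H¹_{B,σ}`)] -/
theorem iSup_iInf_eigenspace_baseChange_eq_top (f : κ → Module.End ℚ V) (hf : ∀ k l, f k * f l = f l * f k)
    (hss : ∀ k, (f k).IsSemisimple) :
    ⨆ χ : κ → ℂ, ⨅ k, Module.End.eigenspace ((f k).baseChange ℂ) (χ k) = ⊤ :=
  iSup_iInf_eigenspace_eq_top_of_isSemisimple_baseChange f hf fun k => Motives.isSemisimple_baseChange (hss k)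

/-- **Joint eigenvectors span the complexification (semisimplicity checked after complexification).** For a
pairwise commuting family `f k` of endomorphisms of a finite-dimensional `ℚ`-vector space `V` with semisimple
complexifications, every `x ∈ ℂ ⊗_ℚ V` is a `ℂ`-linear combination of JOINT EIGENVECTORS `w` (`(f k)_ℂ w = χ k • w`
for all `k`, for some `χ : κ → ℂ`). [cite: Deligne1982HodgeCycles, Example 3.7 and §4 (p. 30, `H¹_B ⊗ ℂ = ⊕_σ H¹_{B,σ}`)] -/
theorem mem_span_jointEigenvectors_of_isSemisimple_baseChange (f : κ → Module.End ℚ V)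
    (hf : ∀ k l, f k * f l = f l * f k) (hss : ∀ k, Module.End.IsSemisimple ((f k).baseChange ℂ))
    (x : ℂ ⊗[ℚ] V) :
    x ∈ Submodule.span ℂ {w : ℂ ⊗[ℚ] V | ∃ χ : κ → ℂ, ∀ k, (f k).baseChange ℂ w = χ k • w} := by
  have htop := iSup_iInf_eigenspace_eq_top_of_isSemisimple_baseChange f hf hss
  have hle : (⨆ χ : κ → ℂ, ⨅ k, Module.End.eigenspace ((f k).baseChange ℂ) (χ k)) ≤
      Submodule.span ℂ {w : ℂ ⊗[ℚ] V | ∃ χ : κ → ℂ, ∀ k, (f k).baseChange ℂ w = χ k • w} := by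
    refine iSup_le fun χ => ?_
    intro w hw
    exact Submodule.subset_span ⟨χ, fun k => Module.End.mem_eigenspace_iff.1 ((Submodule.mem_iInf _).1 hw k)⟩
  exact hle (htop ▸ Submodule.mem_top)

/-- **Joint eigenvectors span the complexification.** For a pairwise commuting family of semisimple
endomorphisms `f k` of a finite-dimensional `ℚ`-vector space `V`, every `x ∈ ℂ ⊗_ℚ V` is a `ℂ`-linear combination of
JOINT EIGENVECTORS `w` (`(f k)_ℂ w = χ k • w` for all `k`, for some `χ : κ → ℂ`). [cite: Deligne1982HodgeCycles, Example 3.7 and §4 (p. 30, `H¹_B ⊗ ℂ = ⊕_σ H¹_{B,σ}`)] -/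
theorem mem_span_jointEigenvectors_of_isSemisimple (f : κ → Module.End ℚ V) (hf : ∀ k l, f k * f l = f l * f k)
    (hss : ∀ k, (f k).IsSemisimple) (x : ℂ ⊗[ℚ] V) :
    x ∈ Submodule.span ℂ {w : ℂ ⊗[ℚ] V | ∃ χ : κ → ℂ, ∀ k, (f k).baseChange ℂ w = χ k • w} :=
  mem_span_jointEigenvectors_of_isSemisimple_baseChange f hf (fun k => Motives.isSemisimple_baseChange (hss k)) x

end Family

/-! ## §2 Algebras: the eigencharacter of a non-zero joint eigenvector is an eigensystem `t : R →ₐ[ℚ] ℂ` -/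

section Algebra

variable {R : Type*} [CommRing R] [Algebra ℚ R] {V : Type*} [AddCommGroup V] [Module ℚ V]

/-- **The eigencharacter of a non-zero joint eigenvector is an algebra homomorphism.** If `w ≠ 0` in `ℂ ⊗_ℚ V`
satisfies `(act a)_ℂ w = χ a • w` for all `a ∈ R`, then `χ = t` for a (unique) `ℚ`-algebra homomorphism
`t : R →ₐ[ℚ] ℂ` (compare coefficients of `w`: `act` is unital, multiplicative, additive and `ℚ`-linear).
[cite: Deligne1982HodgeCycles, §4 (p. 30, `e ∈ E` acting on `H¹_{B,σ}` as `σ(e)`)] -/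
theorem exists_algHom_eq_of_eigenvector_ne_zero (act : R →ₐ[ℚ] Module.End ℚ V) {χ : R → ℂ} {w : ℂ ⊗[ℚ] V}
    (hw : ∀ a, (act a).baseChange ℂ w = χ a • w) (hw0 : w ≠ 0) :
    ∃ t : R →ₐ[ℚ] ℂ, ∀ a, t a = χ a := by
  have hcancel : ∀ c c' : ℂ, c • w = c' • w → c = c' := by
    intro c c' h
    by_contra hne
    apply hw0
    have h0 : (c - c') • w = 0 := by rw [sub_smul, h, sub_self]
    exact (smul_eq_zero.1 h0).resolve_left (sub_ne_zero.2 hne)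
  have h1 : χ 1 = 1 := hcancel _ _ (by rw [← hw 1, map_one, LinearMap.baseChange_one, one_smul]; rfl)
  have hmul : ∀ a b, χ (a * b) = χ a * χ b := fun a b => hcancel _ _ (by
    rw [← hw (a * b), map_mul, LinearMap.baseChange_mul, Module.End.mul_apply, hw b, map_smul, hw a,
      smul_smul, mul_comm])
  have h0 : χ 0 = 0 := hcancel _ _ (by rw [← hw 0, map_zero, LinearMap.baseChange_zero, LinearMap.zero_apply,
    zero_smul])
  have hadd : ∀ a b, χ (a + b) = χ a + χ b := fun a b => hcancel _ _ (by
    rw [← hw (a + b), map_add, LinearMap.baseChange_add, LinearMap.add_apply, hw a, hw b, add_smul])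
  have halg : ∀ q : ℚ, χ (algebraMap ℚ R q) = algebraMap ℚ ℂ q := fun q => hcancel _ _ (by
    rw [← hw (algebraMap ℚ R q), AlgHom.commutes, Algebra.algebraMap_eq_smul_one, LinearMap.baseChange_smul,
      LinearMap.baseChange_one, LinearMap.smul_apply, Module.End.one_apply, algebraMap_smul])
  exact ⟨{ toFun := χ, map_one' := h1, map_mul' := hmul, map_zero' := h0, map_add' := hadd, commutes' := halg },
    fun a => rfl⟩

variable [Module.Finite ℚ V]

/-- **Eigensystem vectors span the complexification (semisimplicity checked after complexification).** Let a
commutative `ℚ`-algebra `R` act on a finite-dimensional `ℚ`-vector space `V` by `act : R →ₐ[ℚ] End_ℚ V` with every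
complexification `(act a)_ℂ` semisimple. Then every `x ∈ ℂ ⊗_ℚ V` lies in the `ℂ`-span of
`{w | ∃ t : R →ₐ[ℚ] ℂ, ∀ a, (act a)_ℂ w = t a • w}` (a joint eigenvector is `0` or its eigencharacter is an eigensystem,
`exists_algHom_eq_of_eigenvector_ne_zero`). [cite: Deligne1982HodgeCycles, Example 3.7 and §4 (p. 30, `H¹_B ⊗ ℂ = ⊕_σ H¹_{B,σ}`)] -/
theorem mem_span_eigensystemVectors_of_isSemisimple_baseChange (act : R →ₐ[ℚ] Module.End ℚ V)
    (hss : ∀ a, Module.End.IsSemisimple ((act a).baseChange ℂ)) (x : ℂ ⊗[ℚ] V) :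
    x ∈ Submodule.span ℂ {w : ℂ ⊗[ℚ] V | ∃ t : R →ₐ[ℚ] ℂ, ∀ a, (act a).baseChange ℂ w = t a • w} := by
  have h := mem_span_jointEigenvectors_of_isSemisimple_baseChange (fun a : R => act a)
    (fun a b => by rw [← map_mul, ← map_mul, mul_comm]) hss x
  refine (Submodule.span_le.2 ?_) h
  rintro w ⟨χ, hw⟩
  by_cases hw0 : w = 0
  · rw [hw0]; exact Submodule.zero_mem _
  · obtain ⟨t, ht⟩ := exists_algHom_eq_of_eigenvector_ne_zero act hw hw0
    exact Submodule.subset_span ⟨t, fun a => by rw [ht]; exact hw a⟩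

/-- **Eigensystem vectors span the complexification (semisimple action).** Let a commutative `ℚ`-algebra `R` act
on a finite-dimensional `ℚ`-vector space `V` by `act : R →ₐ[ℚ] End_ℚ V` with every `act a` SEMISIMPLE. Then every
`x ∈ ℂ ⊗_ℚ V` lies in the `ℂ`-span of `{w | ∃ t : R →ₐ[ℚ] ℂ, ∀ a, (act a)_ℂ w = t a • w}` — literally the hypothesis
`hspan` of `HodgeTheory.isOfCMType_of_forall_eigensystem_oneType` (`V ⊗ ℂ = ⊕_t V_t` over the eigensystems).
[cite: Deligne1982HodgeCycles, Example 3.7 and §4 (p. 30, `H¹_B ⊗ ℂ = ⊕_σ H¹_{B,σ}`)] -/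
theorem mem_span_eigensystemVectors_of_isSemisimple (act : R →ₐ[ℚ] Module.End ℚ V)
    (hss : ∀ a, (act a).IsSemisimple) (x : ℂ ⊗[ℚ] V) :
    x ∈ Submodule.span ℂ {w : ℂ ⊗[ℚ] V | ∃ t : R →ₐ[ℚ] ℂ, ∀ a, (act a).baseChange ℂ w = t a • w} :=
  mem_span_eigensystemVectors_of_isSemisimple_baseChange act (fun a => Motives.isSemisimple_baseChange (hss a)) x

/-! ## §3 Where semisimplicity comes from: reduced algebras, reduced images -/

omit [Module.Finite ℚ V] in
/-- **A reduced finite `ℚ`-algebra acts by semisimple endomorphisms.** For `S` a reduced finite `ℚ`-algebra (not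
necessarily commutative here; e.g. a product of number fields `∏ Kᵢ`, Deligne's `E`), every `act a` is semisimple:
it is killed by the minimal polynomial of `a` over `ℚ`, which is square-free (radical, as `S` is reduced) — Mathlib
`Module.End.isSemisimple_of_squarefree_aeval_eq_zero`. (Same argument as the tree's
`NumberTheory.ComplexMultiplication.ringHom_apply_isSemisimple`, universe-polymorphic.)
[cite: Deligne1982HodgeCycles, Example 3.7 (`E ⊗_ℚ ℂ ≃ ℂ^S`)] -/
theorem isSemisimple_apply_of_isReduced {S : Type*} [Ring S] [Algebra ℚ S] [IsReduced S] [Module.Finite ℚ S]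
    (act : S →ₐ[ℚ] Module.End ℚ V) (a : S) : (act a).IsSemisimple := by
  have hint : IsIntegral ℚ a := Algebra.IsIntegral.isIntegral a
  have hsq : Squarefree (minpoly ℚ a) := (minpoly.isRadical ℚ a).squarefree (minpoly.ne_zero hint)
  refine Module.End.isSemisimple_of_squarefree_aeval_eq_zero hsq ?_
  rw [Polynomial.aeval_algHom_apply, minpoly.aeval, map_zero]

/-- **A reduced image acts by semisimple endomorphisms.** If no `act a` is a non-zero nilpotent (the image
`act(R) ⊆ End_ℚ V`, a finite `ℚ`-algebra, is REDUCED), then every `act a` is semisimple: apply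
`isSemisimple_apply_of_isReduced` to the inclusion of the finite reduced `ℚ`-algebra `act(R)`.
[cite: Deligne1982HodgeCycles, Example 3.7 (`E ⊗_ℚ ℂ ≃ ℂ^S`)] -/
theorem isSemisimple_apply_of_isNilpotent_imp_eq_zero (act : R →ₐ[ℚ] Module.End ℚ V)
    (hred : ∀ a, IsNilpotent (act a) → act a = 0) (a : R) : (act a).IsSemisimple := by
  haveI : IsReduced act.range := ⟨fun x hx => by
    obtain ⟨n, hn⟩ := hx
    obtain ⟨b, hb⟩ := (AlgHom.mem_range act).1 x.2
    have hnil : IsNilpotent (act b) := ⟨n, by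
      have h := congrArg Subtype.val hn
      rw [hb]
      simpa using h⟩
    exact Subtype.ext (by rw [← hb]; exact hred b hnil)⟩
  haveI : Module.Finite ℚ act.range :=
    Module.Finite.of_injective act.range.val.toLinearMap Subtype.val_injective
  exact isSemisimple_apply_of_isReduced act.range.val ⟨act a, (AlgHom.mem_range act).2 ⟨a, rfl⟩⟩

/-- **Eigensystem vectors span the complexification (reduced algebra).** `mem_span_eigensystemVectors_of_isSemisimple`
for `R` a reduced finite commutative `ℚ`-algebra. [cite: Deligne1982HodgeCycles, Example 3.7 and §4 (p. 30, `H¹_B ⊗ ℂ = ⊕_σ H¹_{B,σ}`)] -/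
theorem mem_span_eigensystemVectors_of_isReduced [IsReduced R] [Module.Finite ℚ R]
    (act : R →ₐ[ℚ] Module.End ℚ V) (x : ℂ ⊗[ℚ] V) :
    x ∈ Submodule.span ℂ {w : ℂ ⊗[ℚ] V | ∃ t : R →ₐ[ℚ] ℂ, ∀ a, (act a).baseChange ℂ w = t a • w} :=
  mem_span_eigensystemVectors_of_isSemisimple act (isSemisimple_apply_of_isReduced act) x

/-- **Eigensystem vectors span the complexification (reduced image).** `mem_span_eigensystemVectors_of_isSemisimple`
when no `act a` is a non-zero nilpotent. [cite: Deligne1982HodgeCycles, Example 3.7 and §4 (p. 30, `H¹_B ⊗ ℂ = ⊕_σ H¹_{B,σ}`)] -/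
theorem mem_span_eigensystemVectors_of_isNilpotent_imp_eq_zero (act : R →ₐ[ℚ] Module.End ℚ V)
    (hred : ∀ a, IsNilpotent (act a) → act a = 0) (x : ℂ ⊗[ℚ] V) :
    x ∈ Submodule.span ℂ {w : ℂ ⊗[ℚ] V | ∃ t : R →ₐ[ℚ] ℂ, ∀ a, (act a).baseChange ℂ w = t a • w} :=
  mem_span_eigensystemVectors_of_isSemisimple act (isSemisimple_apply_of_isNilpotent_imp_eq_zero act hred) x

end Algebra

end Literature.AlgebraicGeometry.ComplexMultiplication

end
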